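import Summits.AtomisticToContinuum.Crystallization.Theorems.FrustratedLawDichotomyStrainedPatchDirect

/-!
# «GradedCharts» — the REDESIGN of the [CORE-FAR] engine after census OUTER30: charts with a RADIAL TOLERANCE PROFILE, no window rows, no fixed-radius basin
# (27623 strained-patch piece, T-side [CORE-FAR]; decomp-a2c lens-5 «finite range + asymptotic regime + bridge», generation 58; answers OUTER30 §8 item 9 (iii))

WHAT DIED (census g30 OUTER30/REG30, numbers not adjectives).  In the line of record 56K/57Q the coarse chart tolerance is the CONSTANT `τ₀ = 1/4` on the whole
`63/10`-ball, the fine tolerance lives on the UNCAPPED rim only, and the interior is localised afterwards by (BASᴾ-fix `δ₀ = 1/20`) and certified by an LP whose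
margins rest on the LOWER-WINDOW rows — Danskin linearisations of the reverse-convex «misfit ≥ 1/20», an INNER approximation: with the sound rows only,
RELIEF = 46–96 % and Q_cert = 109–360 % of `S_hom` (K2 ✗ at all six hosts), the structure-free inflation bootstrap has no fixed point (κ_needed(0) = 36…690, K1 ✗),
and the slaving smallness in sup norm fails by ≥ ×8 even with the affine structure.  The binder is not refuted; its certificate technology is.

THE REDESIGN (one idea).  The adversary's room in those LPs is the roughness box `4T₀ ≈ 0.015–0.06` around a FIXED host.  But (F2) lets US choose the chart, and a
force-capped clean single-phase interior is discretely `C`-HARMONIC up to `σ₁ + X(R)` (`X(R)` = exterior slack at radius `R`, census §6: `0.23σ₁` at `R ≤ 9/5`,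
`≈ 1σ₁` at `R ≈ 3`, `5.7σ₁` at `9/2`, `≫` beyond): modulo the best-fit cubic bend (`𝓑₀ = polyBends`, which absorbs every equilibrated polynomial field of degree `≤ 3`)
the deviation from the chart DECAYS INWARD like the degree-`≥ 4` modes, `τ(R) ≈ τ_rim·(R/R_rim)⁴` — `≈ 2·10⁻³` on the `9/5`-core, `≈ 6·10⁻³` at `R = 5/2`, `≈ 1.3·10⁻²`
at `R = 3`, the coarse `1/4` at the rim.  So the chart tolerance should be a RADIAL PROFILE `τ : ℝ → ℝ`, tight where the score's gradient mass lives (the core and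
its first shells) and loose where it does not (the `W₄₅` tail beyond `3`, `ℓ¹`-mass `≈ 10⁻²` of the total).  With the profile in the chart: (i) the fixed-radius
basin piece disappears (the localisation IS the chart); (ii) the window rows disappear (at amplitude `τ(R) ≤ 6·10⁻³` inside `5/2` the sound OUT0 relief scales to
`≈ 5–12 %` of `S_hom` and the quadratic column to `≈ 1–8 %`, planning extrapolation from OUTER30 §3 — to be MEASURED, kill numbers below); (iii) the second-order
force remainder lives at relative bond strain `≈ 4τ(R)/R ≈ 4·10⁻³` inside `5/2`, where even the structure-free constant gives `c₂ε² ≈ 0.02σ₁` (K1's obstruction was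
the amplitude, not the constant).

THE PIECES (all parametric; this file PROVES only the seams — every piece is tagged UNDECIDED until census g31 runs the graded instruments):
* (ROOMᵍ τ) `FamilyRoomG 𝓘 ρ ε η₂ τ` [GEOMETRIC-MECHANICAL — INTERIOR REGULARITY; IDEA-NEEDED → INSTRUMENTABLE]: every far-class record cluster with an `η₂`-good
  centre admits, modulo a linear isometry, a chart by an instance of `𝓘` within the profile `τ(R)` at every site of the `63/10`-ball.  At the constant profile
  `τ ≡ τ₀` it is IMPLIED by the record's (F2) `FamilyRoom` (`familyRoomG_const_of_familyRoom`); the content is the decay of the profile inward, i.e. discrete interior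
  regularity of near-equilibria modulo cubic Cauchy–Born charts (Thomée-type interior estimates for the lattice operator + the force cap (FC σ₁), PROVED in «ForceCap»).
* (ENVᵍ τ Φ) `FamilyEnvelopeG 𝓘 τ Φ` [ANALYTIC; INSTRUMENTABLE]: a cluster so charted scores `≥ S(z₀) − Φ(z₀)`.  Level 2 (not typed here): Lipschitz columns
  `Σ_shells |G_R|₁·τ(R)` for the `W₄₅` tail + the sound force-row LP (no window rows) on the mechanical zone `R ≤ 3`.
* (CERTᵍ Φ) `FamilyCertG 𝓘 φ Φ` [INSTRUMENTABLE]: `φ ≤ S(z₀) − Φ(z₀)` on the family.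
* [BRIDGE] `BandFarFloor`, [SOFT-FAR] `SoftFarFloor` — the tree's pieces, unchanged.
SEAMS PROVED: `edgeFar_of_graded`, `coreOff_of_graded` (parametric), `coreOff_record_g58g` (the record: `𝓘 = ChartFamilyD`, `ρ = 24/5`, `ε = 1/100`, `η_E = 3/50`,
`η₂ = 1/10`, `φ = 0`, profile and modulus free).  ORDER STRUCTURE PROVED: graded charts are antitone/monotone in the profile (`GradedChartBy.mono`), a record chart
`ChartBy 𝓘 τ t` is a graded chart at the constant profile (`gradedChartBy_of_chartBy`), (F2) ⟹ (ROOMᵍ ≡ τ), (ENVᵍ ≡ τ) ⟹ (F1-law) for every law and the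
`t`-independent modulus (`familyEnvelopeLaw_of_envelopeG_const`) — so at the constant profile the graded architecture is the record's with the fine clause
forgotten (weaker room, stronger envelope), and the profile is exactly the dial that trades between them.

KILL NUMBERS (for census g31; each is one projection added to reg30.py / outer30.py):
(G1) the certified LINEAR profile: `τ_lin(R) := sup {‖(u − Π_{𝓑₀} u)(a)‖ : R_a ≤ R, |H u| ≤ σ₁ + X(·) row-wise on R ≤ 3, ‖u‖ ≤ τ₀ on 3 < R ≤ 63/10}` at the six
hosts — PASS iff `τ_lin(9/5) ≤ 3·10⁻³` and `τ_lin(5/2) ≤ 10⁻²`; (G2) graded RELIEF + Q_cert over the box `τ_lin(R)` ∩ sound force rows, NO window rows — PASS iff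
`M_D ≥ +10 %` at the class-P hosts; (G3) the `ℓ¹`-mass of the score gradient by radial shell `|G_R|₁` (decides how loose the rim may be); (G4) the inflation
bootstrap at graded amplitude — PASS iff a fixed point `κ* ≤ 1` exists.  Any FAIL of (G1) at the core radius kills the redesign as typed (the profile cannot be
supplied by harmonic decay from a `1/4` rim); FAIL of (G2) with (G1) passing says the rim tolerance `τ₀ = 1/4` itself must be improved (a geometric piece on
clean single-phase shells), not the interior.

No `sorry`, no new axiom, no `instance`, no `notation`; imports the tree's `…StrainedPatchDirect` only (independent of the unlanded g57/g58 files).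
-/

namespace Summit.AtomisticToContinuum.Crystallization.Theorems.FrustratedLawDichotomyStrainedPatchGradedCharts

open scoped BigOperators Classical
open Summit.AtomisticToContinuum.Crystallization.Theorems.FrustratedLawDichotomyMotifLemmas
open Summit.AtomisticToContinuum.Crystallization.Theorems.FrustratedLawDichotomyAveragingCut
open Summit.AtomisticToContinuum.Crystallization.Theorems.FrustratedLawDichotomyAveragingRuleCap
open Summit.AtomisticToContinuum.Crystallization.Theorems.FrustratedLawDichotomyAveragingRuleTightFree
open Summit.AtomisticToContinuum.Crystallization.Theorems.FrustratedLawDichotomyStrainedPatchHomSplit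
open Summit.AtomisticToContinuum.Crystallization.Theorems.FrustratedLawDichotomyStrainedPatchCleanCollar
open Summit.AtomisticToContinuum.Crystallization.Theorems.FrustratedLawDichotomyStrainedPatchHomIsometry
open Summit.AtomisticToContinuum.Crystallization.Theorems.FrustratedLawDichotomyStrainedPatchHomTubeIso
open Summit.AtomisticToContinuum.Crystallization.Theorems.FrustratedLawDichotomyStrainedPatchPhaseCut
open Summit.AtomisticToContinuum.Crystallization.Theorems.FrustratedLawDichotomyStrainedPatchCoreTube
open Summit.AtomisticToContinuum.Crystallization.Theorems.FrustratedLawDichotomyStrainedPatchStrainBands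
open Summit.AtomisticToContinuum.Crystallization.Theorems.FrustratedLawDichotomyStrainedPatchChartFamilies
open Summit.AtomisticToContinuum.Crystallization.Theorems.FrustratedLawDichotomyStrainedPatchChartFamiliesBent
open Summit.AtomisticToContinuum.Crystallization.Theorems.FrustratedLawDichotomyStrainedPatchChartFamiliesPinned
open Summit.AtomisticToContinuum.Crystallization.Theorems.FrustratedLawDichotomyStrainedPatchDirect

/-! ## §1. Charts with a radial tolerance profile -/

/-- **`GradedChartBy 𝓘 τ z c z₀ c₀ e`** — `ChartBy` with the constant coarse tolerance replaced by a RADIAL PROFILE `τ : ℝ → ℝ` and the rim-only fine clause dropped: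
`𝓘 M₀ z₀ c₀`, `e` centre to centre, the site at distance `R ≤ 63/10` from the centre deviates (in position relative to the centres) by at most `τ R` from its image,
`e` injective on the ball and covering the instance's `(63/10 − τ (63/10))`-ball. -/
def GradedChartBy (𝓘 : (M₀ : ℕ) → (Fin M₀ → E3) → Fin M₀ → Prop) (τ : ℝ → ℝ) {M : ℕ} (z : Fin M → E3) (c : Fin M) {M₀ : ℕ} (z₀ : Fin M₀ → E3)
    (c₀ : Fin M₀) (e : Fin M → Fin M₀) : Prop :=
  𝓘 M₀ z₀ c₀ ∧ e c = c₀ ∧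
    (∀ a, dist (z a) (z c) ≤ 63 / 10 → dist (z a - z c) (z₀ (e a) - z₀ c₀) ≤ τ (dist (z a) (z c))) ∧
    (∀ a b, dist (z a) (z c) ≤ 63 / 10 → dist (z b) (z c) ≤ 63 / 10 → e a = e b → a = b) ∧
    (∀ b₀, dist (z₀ b₀) (z₀ c₀) ≤ 63 / 10 - τ (63 / 10) → ∃ a, dist (z a) (z c) ≤ 63 / 10 ∧ e a = b₀)

/-- A graded chart is a graded chart for every pointwise LARGER profile. [formal bookkeeping] -/
theorem GradedChartBy.mono {𝓘 : (M₀ : ℕ) → (Fin M₀ → E3) → Fin M₀ → Prop} {τ τ' : ℝ → ℝ} (hle : ∀ R, τ R ≤ τ' R) {M : ℕ} {z : Fin M → E3} {c : Fin M}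
    {M₀ : ℕ} {z₀ : Fin M₀ → E3} {c₀ : Fin M₀} {e : Fin M → Fin M₀} (h : GradedChartBy 𝓘 τ z c z₀ c₀ e) : GradedChartBy 𝓘 τ' z c z₀ c₀ e := by
  obtain ⟨hI, hc, hdev, hinj, hcov⟩ := h
  refine ⟨hI, hc, fun a ha => (hdev a ha).trans (hle _), hinj, fun b₀ hb₀ => hcov b₀ ?_⟩
  have := hle (63 / 10)
  linarith

/-- A graded chart by a member of a smaller family is one by a member of the larger. [formal bookkeeping] -/
theorem GradedChartBy.mono_family {𝓘 𝓘' : (M₀ : ℕ) → (Fin M₀ → E3) → Fin M₀ → Prop} (hle : FamilyLE 𝓘 𝓘') {τ : ℝ → ℝ} {M : ℕ} {z : Fin M → E3}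
    {c : Fin M} {M₀ : ℕ} {z₀ : Fin M₀ → E3} {c₀ : Fin M₀} {e : Fin M → Fin M₀} (h : GradedChartBy 𝓘 τ z c z₀ c₀ e) : GradedChartBy 𝓘' τ z c z₀ c₀ e :=
  ⟨hle _ _ _ h.1, h.2⟩

/-- ★ A record chart `ChartBy 𝓘 τ t` IS a graded chart at the CONSTANT profile `τ` (the rim-only fine clause is forgotten). [formal bookkeeping] -/
theorem gradedChartBy_of_chartBy {𝓘 : (M₀ : ℕ) → (Fin M₀ → E3) → Fin M₀ → Prop} {τ t : ℝ} {M : ℕ} {z : Fin M → E3} {c : Fin M} {M₀ : ℕ}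
    {z₀ : Fin M₀ → E3} {c₀ : Fin M₀} {e : Fin M → Fin M₀} (h : ChartBy 𝓘 τ t z c z₀ c₀ e) : GradedChartBy 𝓘 (fun _ => τ) z c z₀ c₀ e :=
  ⟨h.1, h.2.1, h.2.2.1, h.2.2.2.2.1, h.2.2.2.2.2⟩

/-- **`quarticProfile τc τm ρm τo`** — the planning shape of the profile: the degree-4 harmonic decay `τc + (τm − τc)·(R/ρm)⁴` on the mechanical zone `R ≤ ρm`,
the coarse constant `τo` outside.  Planning values (NOT pins; census (G1) decides): `ρm = 3`, `τo = τ₀ = 1/4`, `τc ≈ 1–2·10⁻³`, `τm ≈ 1–2·10⁻²`. -/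
noncomputable def quarticProfile (τc τm ρm τo : ℝ) : ℝ → ℝ := fun R => if R ≤ ρm then τc + (τm - τc) * (R / ρm) ^ 4 else τo

/-- On the mechanical zone the quartic profile runs from `τc` (centre) and stays below `τm` (`0 ≤ τc ≤ τm`, `0 < ρm`, `0 ≤ R ≤ ρm`). [formal bookkeeping] -/
theorem quarticProfile_le_of_le {τc τm ρm τo R : ℝ} (hcm : τc ≤ τm) (hρ : 0 < ρm) (hR₀ : 0 ≤ R) (hR : R ≤ ρm) :
    τc ≤ quarticProfile τc τm ρm τo R ∧ quarticProfile τc τm ρm τo R ≤ τm := by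
  simp only [quarticProfile, if_pos hR]
  have h01 : 0 ≤ R / ρm ∧ R / ρm ≤ 1 := ⟨div_nonneg hR₀ hρ.le, (div_le_one hρ).2 hR⟩
  have hp : 0 ≤ (R / ρm) ^ 4 ∧ (R / ρm) ^ 4 ≤ 1 := ⟨pow_nonneg h01.1 4, pow_le_one₀ h01.1 h01.2⟩
  constructor <;> nlinarith [hp.1, hp.2]

/-- Outside the mechanical zone the quartic profile IS the coarse constant. [formal bookkeeping] -/
theorem quarticProfile_of_lt {τc τm ρm τo R : ℝ} (hR : ρm < R) : quarticProfile τc τm ρm τo R = τo := by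
  simp only [quarticProfile, if_neg (not_le.2 hR)]

/-! ## §2. The three graded pieces and the seams -/

/-- **(ROOMᵍ τ) `FamilyRoomG 𝓘 ρ ε η₂ τ` [GEOMETRIC-MECHANICAL — INTERIOR REGULARITY]** — every far-class record cluster (admissible, clean and of one stacking word
within `63/10`, `ρ`-core `ε`-far modulo isometry, centre `η₂`-good) admits, modulo a linear isometry, a chart by an instance of `𝓘` within the PROFILE `τ`. -/
def FamilyRoomG (𝓘 : (M₀ : ℕ) → (Fin M₀ → E3) → Fin M₀ → Prop) (ρ ε η₂ : ℝ) (τ : ℝ → ℝ) : Prop :=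
  ∀ (M : ℕ) (z : Fin M → E3) (c : Fin M), Admissible M z c → CleanBall (63 / 10) z c → MonoPhaseBall (63 / 10) z c → ¬NearHomIsoAt ρ ε z c →
    GoodAtScale η₂ (3 / 2) z c →
      ∃ (R : E3 ≃ₗᵢ[ℝ] E3) (M₀ : ℕ) (z₀ : Fin M₀ → E3) (c₀ : Fin M₀) (e : Fin M → Fin M₀), GradedChartBy 𝓘 τ (⇑R ∘ z) c z₀ c₀ e

/-- **(ENVᵍ τ Φ) `FamilyEnvelopeG 𝓘 τ Φ` [ANALYTIC]** — an admissible record cluster, clean and single-phase within `63/10`, charted within the profile `τ` by an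
instance of `𝓘`, scores at least the instance's score minus the modulus `Φ(z₀)` (a number per instance: the profile is fixed, there is no roughness argument). -/
def FamilyEnvelopeG (𝓘 : (M₀ : ℕ) → (Fin M₀ → E3) → Fin M₀ → Prop) (τ : ℝ → ℝ) (Φ : (M₀ : ℕ) → (Fin M₀ → E3) → Fin M₀ → ℝ) : Prop :=
  ∀ (M : ℕ) (z : Fin M → E3) (c : Fin M) (M₀ : ℕ) (z₀ : Fin M₀ → E3) (c₀ : Fin M₀) (e : Fin M → Fin M₀),
    Admissible M z c → CleanBall (63 / 10) z c → MonoPhaseBall (63 / 10) z c → GradedChartBy 𝓘 τ z c z₀ c₀ e →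
      ballAvg (9 / 5) z₀ (xRec M₀ z₀) c₀ - Φ M₀ z₀ c₀ ≤ ballAvg (9 / 5) z (xRec M z) c

/-- **(CERTᵍ Φ) `FamilyCertG 𝓘 φ Φ` [CERTIFICATE over the family, INSTRUMENTABLE]** — on every instance the enveloped score clears the floor: `φ ≤ S(z₀) − Φ(z₀)`. -/
def FamilyCertG (𝓘 : (M₀ : ℕ) → (Fin M₀ → E3) → Fin M₀ → Prop) (φ : ℝ) (Φ : (M₀ : ℕ) → (Fin M₀ → E3) → Fin M₀ → ℝ) : Prop :=
  ∀ (M₀ : ℕ) (z₀ : Fin M₀ → E3) (c₀ : Fin M₀), 𝓘 M₀ z₀ c₀ → φ ≤ ballAvg (9 / 5) z₀ (xRec M₀ z₀) c₀ - Φ M₀ z₀ c₀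

/-- ★★ THE LEVEL-0 SEAM: (ENVᵍ) ∧ (ROOMᵍ) ∧ (CERTᵍ) ⟹ `EdgeFarFloor (63/10) (63/10) ρ ε η₂ φ` — chart the rotated cluster, envelope it, certify the instance
(the score is isometry-invariant). [folklore] -/
theorem edgeFar_of_graded {𝓘 : (M₀ : ℕ) → (Fin M₀ → E3) → Fin M₀ → Prop} {ρ ε η₂ φ : ℝ} {τ : ℝ → ℝ} {Φ : (M₀ : ℕ) → (Fin M₀ → E3) → Fin M₀ → ℝ}
    (hE : FamilyEnvelopeG 𝓘 τ Φ) (hR : FamilyRoomG 𝓘 ρ ε η₂ τ) (hC : FamilyCertG 𝓘 φ Φ) : EdgeFarFloor (63 / 10) (63 / 10) ρ ε η₂ φ := by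
  intro M z c hz hcl hm hn hg
  obtain ⟨R, M₀, z₀, c₀, e, hch⟩ := hR M z c hz hcl hm hn hg
  have h₁ := hE M (⇑R ∘ z) c M₀ z₀ c₀ e ((admissible_comp_iff R z c).2 hz) ((cleanBall_comp_iff R z c).2 hcl)
    ((monoPhaseBall_comp_iff R z c).2 hm) hch
  rw [ballAvg_xRec_comp] at h₁
  have h₃ := hC M₀ z₀ c₀ hch.1
  linarith

/-- ★★ THE PARAMETRIC NODE: (ENVᵍ) ∧ (ROOMᵍ) ∧ (CERTᵍ) ∧ [BRIDGE] ∧ [SOFT-FAR] ⟹ `CoreOffTubeFloor (63/10) (63/10) ρ ε φ`. [folklore] -/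
theorem coreOff_of_graded {𝓘 : (M₀ : ℕ) → (Fin M₀ → E3) → Fin M₀ → Prop} {ρ ε ηE η₂ φ : ℝ} {τ : ℝ → ℝ} {Φ : (M₀ : ℕ) → (Fin M₀ → E3) → Fin M₀ → ℝ}
    (hE : FamilyEnvelopeG 𝓘 τ Φ) (hR : FamilyRoomG 𝓘 ρ ε ηE τ) (hC : FamilyCertG 𝓘 φ Φ) (hB : BandFarFloor (63 / 10) (63 / 10) ρ ε ηE η₂ φ)
    (hS : SoftFarFloor (63 / 10) (63 / 10) ρ ε η₂ φ) : CoreOffTubeFloor (63 / 10) (63 / 10) ρ ε φ :=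
  coreOff_of_edge_of_band_of_soft (edgeFar_of_graded hE hR hC) hB hS

/-- ★★★ THE RECORD NODE 58G: over the chart family of record `𝓘₀ᴰ = ChartFamilyD` (admissible `𝓑₀`-bent lattice windows, `1/16`-good centre), at the core-far dial
`(24/5, 1/100)`, bridge edge `η_E = 3/50`, soft edge `1/10`, floor `0`, for ANY profile `τ` and modulus `Φ`:
(ENVᵍ τ Φ) ∧ (ROOMᵍ τ) ∧ (CERTᵍ 0 Φ) ∧ [BRIDGE] ∧ [SOFT-FAR] ⟹ [CORE-FAR] verbatim. [folklore] -/
theorem coreOff_record_g58g (τ : ℝ → ℝ) {Φ : (M₀ : ℕ) → (Fin M₀ → E3) → Fin M₀ → ℝ} (hE : FamilyEnvelopeG ChartFamilyD τ Φ)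
    (hR : FamilyRoomG ChartFamilyD (24 / 5) (1 / 100) etaE τ) (hC : FamilyCertG ChartFamilyD 0 Φ)
    (hBand : BandFarFloor (63 / 10) (63 / 10) (24 / 5) (1 / 100) (3 / 50) (1 / 10) 0) (hS : SoftFarFloor (63 / 10) (63 / 10) (24 / 5) (1 / 100) (1 / 10) 0) :
    CoreOffTubeFloor (63 / 10) (63 / 10) (24 / 5) (1 / 100) 0 := by
  have hR' : FamilyRoomG ChartFamilyD (24 / 5) (1 / 100) (3 / 50) τ := by rw [← show etaE = 3 / 50 from rfl]; exact hR
  exact coreOff_of_graded hE hR' hC hBand hS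

/-! ## §3. The order structure: where the graded architecture sits relative to the record's (F1-law)/(F2)/(F3) -/

/-- (ROOMᵍ) is MONOTONE in the profile and in the family. [formal bookkeeping] -/
theorem FamilyRoomG.mono {𝓘 𝓘' : (M₀ : ℕ) → (Fin M₀ → E3) → Fin M₀ → Prop} (hI : FamilyLE 𝓘 𝓘') {ρ ε η₂ : ℝ} {τ τ' : ℝ → ℝ} (hτ : ∀ R, τ R ≤ τ' R)
    (h : FamilyRoomG 𝓘 ρ ε η₂ τ) : FamilyRoomG 𝓘' ρ ε η₂ τ' := by
  intro M z c hz hcl hm hn hg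
  obtain ⟨R, M₀, z₀, c₀, e, hch⟩ := h M z c hz hcl hm hn hg
  exact ⟨R, M₀, z₀, c₀, e, (hch.mono hτ).mono_family hI⟩

/-- (ENVᵍ) is ANTITONE in the profile and in the family, MONOTONE in the modulus. [formal bookkeeping] -/
theorem FamilyEnvelopeG.anti {𝓘 𝓘' : (M₀ : ℕ) → (Fin M₀ → E3) → Fin M₀ → Prop} (hI : FamilyLE 𝓘 𝓘') {τ τ' : ℝ → ℝ} (hτ : ∀ R, τ R ≤ τ' R)
    {Φ Φ' : (M₀ : ℕ) → (Fin M₀ → E3) → Fin M₀ → ℝ} (hΦ : ∀ (M₀ : ℕ) (z₀ : Fin M₀ → E3) (c₀ : Fin M₀), 𝓘 M₀ z₀ c₀ → Φ M₀ z₀ c₀ ≤ Φ' M₀ z₀ c₀)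
    (h : FamilyEnvelopeG 𝓘' τ' Φ) : FamilyEnvelopeG 𝓘 τ Φ' := by
  intro M z c M₀ z₀ c₀ e hz hcl hm hch
  have h₁ := h M z c M₀ z₀ c₀ e hz hcl hm ((hch.mono hτ).mono_family hI)
  have h₂ := hΦ M₀ z₀ c₀ hch.1
  linarith

/-- ★ THE RECORD'S (F2) IMPLIES (ROOMᵍ) AT THE CONSTANT PROFILE: `FamilyRoom 𝓘 ρ ε η₂ τ T → FamilyRoomG 𝓘 ρ ε η₂ (fun _ => τ)` (the law's fine clause is
forgotten).  So (ROOMᵍ ≡ τ₀) is no stronger than `FamilyRoomBent0`; the CONTENT of (ROOMᵍ τ) is the decay of `τ(R)` below `τ₀` inward. [formal bookkeeping] -/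
theorem familyRoomG_const_of_familyRoom {𝓘 : (M₀ : ℕ) → (Fin M₀ → E3) → Fin M₀ → Prop} {ρ ε η₂ τ : ℝ} {T : (M₀ : ℕ) → (Fin M₀ → E3) → Fin M₀ → ℝ}
    (h : FamilyRoom 𝓘 ρ ε η₂ τ T) : FamilyRoomG 𝓘 ρ ε η₂ (fun _ => τ) := by
  intro M z c hz hcl hm hn hg
  obtain ⟨R, M₀, z₀, c₀, e, _, hch⟩ := h M z c hz hcl hm hn hg
  exact ⟨R, M₀, z₀, c₀, e, gradedChartBy_of_chartBy hch⟩

/-- ★ (ENVᵍ) AT THE CONSTANT PROFILE IMPLIES THE RECORD'S (F1-law) for EVERY law `T` and the `t`-independent modulus: a record chart is a graded chart.  So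
(ENVᵍ ≡ τ₀) is at least as strong as `FamilyEnvelopeLaw 𝓘 τ₀ T (fun … _ => Φ …)` — the profile is the dial that makes (ENVᵍ) affordable. [formal bookkeeping] -/
theorem familyEnvelopeLaw_of_envelopeG_const {𝓘 : (M₀ : ℕ) → (Fin M₀ → E3) → Fin M₀ → Prop} {τ : ℝ} {Φ : (M₀ : ℕ) → (Fin M₀ → E3) → Fin M₀ → ℝ}
    (h : FamilyEnvelopeG 𝓘 (fun _ => τ) Φ) (T : (M₀ : ℕ) → (Fin M₀ → E3) → Fin M₀ → ℝ) :
    FamilyEnvelopeLaw 𝓘 τ T (fun M₀ z₀ c₀ _ => Φ M₀ z₀ c₀) :=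
  fun M z c M₀ z₀ c₀ e _ hz hcl hm _ _ hch => h M z c M₀ z₀ c₀ e hz hcl hm (gradedChartBy_of_chartBy hch)

/-- (CERTᵍ) IS the record's (F3) read with a `t`-independent modulus (any law). [formal bookkeeping] -/
theorem familyCertG_iff_familyCert {𝓘 : (M₀ : ℕ) → (Fin M₀ → E3) → Fin M₀ → Prop} {φ : ℝ} {Φ : (M₀ : ℕ) → (Fin M₀ → E3) → Fin M₀ → ℝ}
    (T : (M₀ : ℕ) → (Fin M₀ → E3) → Fin M₀ → ℝ) : FamilyCertG 𝓘 φ Φ ↔ FamilyCert 𝓘 φ (fun M₀ z₀ c₀ _ => Φ M₀ z₀ c₀) T := Iff.rfl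

/-- ★ THE TRADE AT THE CONSTANT PROFILE, assembled: the record's (F2) and a constant-profile (ENVᵍ)/(CERTᵍ) already give [CORE-FAR] through the RECORD engine
`coreOff_of_familyLaw_of_band_of_soft` — the graded node at `τ ≡ τ₀` is the record node with the fine clause unused. [formal bookkeeping] -/
theorem coreOff_of_envelopeG_const_of_familyRoom {𝓘 : (M₀ : ℕ) → (Fin M₀ → E3) → Fin M₀ → Prop} {ρ ε ηE η₂ τ φ : ℝ}
    {T : (M₀ : ℕ) → (Fin M₀ → E3) → Fin M₀ → ℝ} {Φ : (M₀ : ℕ) → (Fin M₀ → E3) → Fin M₀ → ℝ} (hE : FamilyEnvelopeG 𝓘 (fun _ => τ) Φ)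
    (hR : FamilyRoom 𝓘 ρ ε ηE τ T) (hC : FamilyCertG 𝓘 φ Φ) (hB : BandFarFloor (63 / 10) (63 / 10) ρ ε ηE η₂ φ)
    (hS : SoftFarFloor (63 / 10) (63 / 10) ρ ε η₂ φ) : CoreOffTubeFloor (63 / 10) (63 / 10) ρ ε φ :=
  coreOff_of_familyLaw_of_band_of_soft (familyEnvelopeLaw_of_envelopeG_const hE T) hR ((familyCertG_iff_familyCert T).1 hC) hB hS

end Summit.AtomisticToContinuum.Crystallization.Theorems.FrustratedLawDichotomyStrainedPatchGradedCharts
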